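import Mathlib.NumberTheory.LegendreSymbol.ZModChar
import Mathlib.Analysis.SpecialFunctions.Pow.Real
import Mathlib.Analysis.Complex.Basic
import HarnessLib

set_option autoImplicit false

/-!
# Three elementary digits for the range-cut receptacles at `p = 2`: unit-invariance of the norm readings,
# exact dyadic levels of `χ₄, χ₈, χ₈'` (by `decide`), and non-vanishing of the smoothing factor `φ(𝔞) − N𝔞`
# off weight `2`

Companion of `PrintCf2SplitBadTwoRangeCut{,Receptacles}.lean` and of
`Literature/…/DeShalit1987/LMeasureCosetValuesInertiaType.lean` (`HasExactInertiaLevel`):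

* §1 `norm_mul_le_iff_of_norm_eq_one`, `norm_mul_eq_iff_of_norm_eq_one`, `norm_neg_mul_le_iff` — the value clauses
  `‖val‖ ≤ c` / `‖val‖ = c` are invariant under unit multiples of the value.
* §2 `chi4_exactLevel_two`, `chi8_exactLevel_three`, `chi8'_exactLevel_three`, `chi_table_mod_eight` — the `2`-primary
  quadratic characters take the value `−1` at a unit `≡ 1 (mod 2^{n−1})`, `n = 2, 3, 3` (the finite half of an exact
  inertia level), and are distinguished by their values at `3` and `5`.
* §3 `ne_of_norm_eq_rpow` (`‖φ‖ = N^{w/2}`, `N > 1`, `w ≠ 2` ⟹ `φ ≠ N`), `ne_natCast_of_norm_eq_one`, `smoothingFactor_ne_zero`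
  — the smoothing factor `φ(𝔞) − N𝔞` of de Shalit II.5.2 (4) vanishes only in weight `2`.

All proved; no definition, no named fact.

## References

* [deShalit1987] E. de Shalit, *Iwasawa theory of elliptic curves with complex multiplication* (1987), II.5.2 (4) (p. 79).
-/

noncomputable section

namespace Summit.BirchSwinnertonDyer.Rank1Residual.P2.RangeCut

/-! ## §1 The norm readings are invariant under unit multiples -/

section Perturbation

variable {𝕜 : Type*} [NormedDivisionRing 𝕜]

/-- `‖u‖ = 1` ⟹ (`‖u·z‖ ≤ c ↔ ‖z‖ ≤ c`): the value clause `P := (‖·‖ ≤ 2^{−M/2})` of `MeasureValueOn` is invariant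
under unit multiples of the value (e.g. those produced by a period ambiguity on the `j = 0` range). [folklore] -/
theorem norm_mul_le_iff_of_norm_eq_one {u : 𝕜} (hu : ‖u‖ = 1) (z : 𝕜) (c : ℝ) : ‖u * z‖ ≤ c ↔ ‖z‖ ≤ c := by
  rw [norm_mul, hu, one_mul]

/-- Same for an exact reading `‖val‖ = c`. [folklore] -/
theorem norm_mul_eq_iff_of_norm_eq_one {u : 𝕜} (hu : ‖u‖ = 1) (z : 𝕜) (c : ℝ) : ‖u * z‖ = c ↔ ‖z‖ = c := by
  rw [norm_mul, hu, one_mul]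

/-- The sign case `u = −1`. [folklore] -/
theorem norm_neg_mul_le_iff (z : 𝕜) (c : ℝ) : ‖(-1 : 𝕜) * z‖ ≤ c ↔ ‖z‖ ≤ c := by
  rw [neg_one_mul, norm_neg]

end Perturbation

/-! ## §2 Certified small cases: the three `2`-primary quadratic characters have EXACT dyadic level -/

section ExactLevel

/-- **Exactness witness, level `n = 2`** (`2`-primary inertia character `χ₄`): the unit `3 ≡ 1 (mod 2^{2−1})` has `χ₄(3) = −1`, so `χ₄` is non-trivial on `1 + 2ℤ₂` modulo `1 + 4ℤ₂` — the finite half of an exact inertia level `2`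
(`DeShalit1987.HasExactInertiaLevel` at `n = 2`). [folklore] -/
theorem chi4_exactLevel_two : (3 : ℕ) % 2 ^ (2 - 1) = 1 ∧ ZMod.χ₄ (3 : ZMod 4) = -1 := by decide

/-- **Exactness witness, level `n = 3`, character `χ₈`**: `5 ≡ 1 (mod 2^{3−1})`, `χ₈(5) = −1`. [folklore] -/
theorem chi8_exactLevel_three : (5 : ℕ) % 2 ^ (3 - 1) = 1 ∧ ZMod.χ₈ (5 : ZMod 8) = -1 := by decide

/-- **Exactness witness, level `n = 3`, character `χ₈'`**: `5 ≡ 1 (mod 4)`, `χ₈'(5) = −1`. [folklore] -/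
theorem chi8'_exactLevel_three : (5 : ℕ) % 2 ^ (3 - 1) = 1 ∧ ZMod.χ₈' (5 : ZMod 8) = -1 := by decide

/-- The three 2-primary quadratic characters are DISTINGUISHED on the level-3 units `{1,3,5,7}` by their values at
`3` and `5`. [folklore] -/
theorem chi_table_mod_eight :
    (ZMod.χ₄ (3 : ZMod 4), ZMod.χ₄ (5 : ZMod 4)) = (-1, 1) ∧
    (ZMod.χ₈ (3 : ZMod 8), ZMod.χ₈ (5 : ZMod 8)) = (-1, -1) ∧
    (ZMod.χ₈' (3 : ZMod 8), ZMod.χ₈' (5 : ZMod 8)) = (1, -1) := by decide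

end ExactLevel

/-! ## §3 Extremal weight: the smoothing factor `φ(𝔞) − N𝔞` of de Shalit II.5.2 (4) is nonzero off weight `2` -/

section Weight

/-- **`‖φ‖ = N^{w/2}`, `N > 1`, `w ≠ 2` ⟹ `φ ≠ N`.**  For a Hecke character of infinity type `(k, j)` one has
`|φ(𝔞)|² = N𝔞^{k+j}`; so the smoothing factor `φ(𝔞) − N𝔞` (II.5.2 (4), `𝔞 ≠ 1`) vanishes only in weight
`k + j = 2`: NEVER for the finite-order characters of `IsCosetValues` (`w = 0`) nor for the frame type `(0, −1)`
(`w = −1`) — the 2-adic valuation `v₂(φ(𝔞) − N𝔞)` is then FINITE. [cite: deShalit1987, II.5.2 (4) (p. 79)] -/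
theorem ne_of_norm_eq_rpow {φ : ℂ} {N : ℕ} {w : ℝ} (hN : 1 < N) (hφ : ‖φ‖ = (N : ℝ) ^ (w / 2)) (hw : w ≠ 2) :
    φ ≠ (N : ℂ) := by
  intro h
  have hN' : (1 : ℝ) < (N : ℝ) := by exact_mod_cast hN
  have h1 : ‖φ‖ = (N : ℝ) ^ (1 : ℝ) := by rw [h, Complex.norm_natCast, Real.rpow_one]
  rw [hφ] at h1
  have h2 : w / 2 = 1 := (Real.rpow_right_inj (by linarith) hN'.ne').mp h1
  exact hw (by linarith)

/-- The finite-order case in the currency of `IsCosetValues` (`‖χ(σ_𝔞)‖ = 1 = N𝔞^{0/2}`): a complex number of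
absolute value `1` is not an integer `N > 1`. [cite: deShalit1987, II.5.2 (4) (p. 79)] -/
theorem ne_natCast_of_norm_eq_one {z : ℂ} {N : ℕ} (hN : 1 < N) (hz : ‖z‖ = 1) : z ≠ (N : ℂ) :=
  ne_of_norm_eq_rpow (w := 0) hN (by rw [hz, zero_div, Real.rpow_zero]) (by norm_num)

/-- Hence the smoothing factor `χ(σ_𝔞) − N𝔞` is NONZERO (so its 2-adic valuation is a natural number).
[cite: deShalit1987, II.5.2 (4) (p. 79)] -/
theorem smoothingFactor_ne_zero {z : ℂ} {N : ℕ} (hN : 1 < N) (hz : ‖z‖ = 1) : z - (N : ℂ) ≠ 0 :=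
  sub_ne_zero.mpr (ne_natCast_of_norm_eq_one hN hz)

end Weight

end Summit.BirchSwinnertonDyer.Rank1Residual.P2.RangeCut

end
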